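import Literature.Barriers.NavierStokesRegularity.NavierStokesInequalityArrangement
import Mathlib.Analysis.Calculus.BumpFunction.FiniteDimension
import HarnessLib

/-!
# Scheffer's block, decomposed (2): the recipe for a structure (Ożański 2017, §3.5, Thm. 3.4)

Barrier catalogue support file for `NavierStokesRegularity` (D-0021), first layer of the
decomposition of fact C `NSIArrangementExists` of `NavierStokesInequalityArrangement` (the
existence of the geometric arrangement, Ożański 2017 §5 = Scheffer 1985 §§4–6) along its
printed proof. The arrangement is assembled from *structures* (`IsNSIStructure`, Ożański
Def. 3.3) on rectangles and rectangular rings of the meridian half-plane, and every such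
structure is produced by the **recipe of §3.5**: a solenoidal field `v ∈ C_c^∞(U; ℝ²)`, the
edge-effect cut-off `f` of **Theorem 3.4** (`supp f = Ū`, `f = 1` on `U_η`, `Lf > 0` near `∂U`),
scaled by `μ > ‖v‖_∞`, and a cut-off `φ` with `φ = 1` on `U_δ`.

## What is here

* `rect r₁ r₂ z₁ z₂ = (r₁,r₂) × (z₁,z₂)` and `crect` (closed), the rectangles of the meridian
  plane in the tree's coordinates `q = (r, z)` (Ożański's `(a₁,b₁) × (a₂,b₂)` has the axial
  interval first: his `(a₂,b₂)`, `a₂ > 0`, is our radial `(r₁,r₂)`); a rectangular ring is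
  `rect R₁ R₂ Z₁ Z₂ \ crect r₁ r₂ z₁ z₂` (`V ∖ W̄`). For these sets the `η`-subset
  `U_η = {x ∈ U : dist(x,∂U) > η}` of §3.5 is again of the same shape (inner rectangle shrunk
  by `η`; for the ring, minus the closed rectangle `W̄` enlarged by `η` — this is `U_η` for the
  sup metric of `ℝ × ℝ`; for the Euclidean metric the enlarged `W̄` has rounded corners, an
  immaterial difference since `η` and `δ` are quantified, cf. the docstring of
  `Ozanski2017_cutoff_ring`).
* Two NAMED FACTS (nothing asserted), Theorem 3.4 in its two cases as proved in Appendix A: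
  `Ozanski2017_cutoff_rect` (rectangle, with the symmetry in the axial variable; held-text
  Lemma 21 = App. A "the cut-off function on a rectangle"; Scheffer 1985, Lemmas 5.3–5.4) and
  `Ozanski2017_cutoff_ring` (rectangular ring; held-text Lemma 22; Scheffer 1985, Lemma 5.5).
* PROVED: the cut-off `φ` (`exists_cutoff_eq_one`, from Mathlib's
  `IsOpen.exists_contDiff_support_eq`), compact subsets of rectangles/rings keep a margin
  (`exists_margin_rect`, `exists_margin_ring`), and **the recipe** (§3.5):
  `IsNSIStructure.of_recipe` (abstract form), `exists_structure_rect`, `exists_structure_ring` —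
  given the facts, every smooth `v` supported in `U` with `div(r v) = 0` in `U` and every
  `μ > ‖v‖_∞` carry a structure `(v, f, φ)` on `U` with `f = μ` on `supp v`, `0 ≤ f ≤ μ`
  (and `f` even about the axial midline in the rectangle case).

Numbering: arXiv v4 (theorems numbered within sections), as in
`NavierStokesInequalityArrangement`; the held plain-text rendering numbers globally (its
Thm. 6, Lemmas 19–22 are Thm. 3.4 and the four results of App. A here).

## References

* W. S. Ożański, arXiv:1709.00602v4, §3.5 (recipe, Thm. 3.4), App. A. [`Ozanski2017NSISingular`]
* V. Scheffer, Comm. Math. Phys. 101 (1985), §5 "Edge effects", Lemmas 5.1–5.5. [`Scheffer1985`]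
-/

noncomputable section

open Set Function Filter Topology TopologicalSpace Metric
open scoped ContDiff

namespace Literature.Barriers.NavierStokesRegularity

open Literature.Analysis.FluidPDE

/-! ### Rectangles of the meridian plane -/

/-- The open rectangle `(r₁, r₂) × (z₁, z₂)` of the meridian plane (radial interval first;
Ożański's `(a₁,b₁) × (a₂,b₂)` with `(a₂,b₂)` the radial interval). [folklore] -/
def rect (r₁ r₂ z₁ z₂ : ℝ) : Set (ℝ × ℝ) :=
  Ioo r₁ r₂ ×ˢ Ioo z₁ z₂

/-- The closed rectangle `[r₁, r₂] × [z₁, z₂]`. [folklore] -/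
def crect (r₁ r₂ z₁ z₂ : ℝ) : Set (ℝ × ℝ) :=
  Icc r₁ r₂ ×ˢ Icc z₁ z₂

/-- Membership in an open rectangle. [folklore] -/
@[simp] theorem mem_rect {r₁ r₂ z₁ z₂ : ℝ} {q : ℝ × ℝ} :
    q ∈ rect r₁ r₂ z₁ z₂ ↔ (r₁ < q.1 ∧ q.1 < r₂) ∧ (z₁ < q.2 ∧ q.2 < z₂) := by
  simp only [rect, mem_prod, mem_Ioo]

/-- Membership in a closed rectangle. [folklore] -/
@[simp] theorem mem_crect {r₁ r₂ z₁ z₂ : ℝ} {q : ℝ × ℝ} :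
    q ∈ crect r₁ r₂ z₁ z₂ ↔ (r₁ ≤ q.1 ∧ q.1 ≤ r₂) ∧ (z₁ ≤ q.2 ∧ q.2 ≤ z₂) := by
  simp only [crect, mem_prod, mem_Icc]

/-- Open rectangles are open. [folklore] -/
theorem isOpen_rect (r₁ r₂ z₁ z₂ : ℝ) : IsOpen (rect r₁ r₂ z₁ z₂) :=
  isOpen_Ioo.prod isOpen_Ioo

/-- Closed rectangles are closed. [folklore] -/
theorem isClosed_crect (r₁ r₂ z₁ z₂ : ℝ) : IsClosed (crect r₁ r₂ z₁ z₂) :=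
  isClosed_Icc.prod isClosed_Icc

/-- Closed rectangles are compact. [folklore] -/
theorem isCompact_crect (r₁ r₂ z₁ z₂ : ℝ) : IsCompact (crect r₁ r₂ z₁ z₂) :=
  isCompact_Icc.prod isCompact_Icc

/-- `rect ⊆ crect`. [folklore] -/
theorem rect_subset_crect (r₁ r₂ z₁ z₂ : ℝ) : rect r₁ r₂ z₁ z₂ ⊆ crect r₁ r₂ z₁ z₂ :=
  prod_mono Ioo_subset_Icc_self Ioo_subset_Icc_self

/-- `closure rect ⊆ crect`. [folklore] -/
theorem closure_rect_subset (r₁ r₂ z₁ z₂ : ℝ) : closure (rect r₁ r₂ z₁ z₂) ⊆ crect r₁ r₂ z₁ z₂ :=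
  closure_minimal (rect_subset_crect _ _ _ _) (isClosed_crect _ _ _ _)

/-- For a nondegenerate rectangle, `closure rect = crect`. [folklore] -/
theorem closure_rect {r₁ r₂ z₁ z₂ : ℝ} (hr : r₁ < r₂) (hz : z₁ < z₂) :
    closure (rect r₁ r₂ z₁ z₂) = crect r₁ r₂ z₁ z₂ := by
  rw [rect, closure_prod_eq, closure_Ioo hr.ne, closure_Ioo hz.ne, crect]

/-- Monotonicity of rectangles. [folklore] -/
theorem rect_mono {r₁ r₂ z₁ z₂ r₁' r₂' z₁' z₂' : ℝ} (h₁ : r₁' ≤ r₁) (h₂ : r₂ ≤ r₂') (h₃ : z₁' ≤ z₁)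
    (h₄ : z₂ ≤ z₂') : rect r₁ r₂ z₁ z₂ ⊆ rect r₁' r₂' z₁' z₂' :=
  prod_mono (Ioo_subset_Ioo h₁ h₂) (Ioo_subset_Ioo h₃ h₄)

/-- A closed rectangle strictly inside an open one. [folklore] -/
theorem crect_subset_rect {r₁ r₂ z₁ z₂ r₁' r₂' z₁' z₂' : ℝ} (h₁ : r₁' < r₁) (h₂ : r₂ < r₂')
    (h₃ : z₁' < z₁) (h₄ : z₂ < z₂') : crect r₁ r₂ z₁ z₂ ⊆ rect r₁' r₂' z₁' z₂' :=
  prod_mono (Icc_subset_Ioo h₁ h₂) (Icc_subset_Ioo h₃ h₄)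

/-- A rectangle with `r₁ ≥ 0` lies in the half-plane. [folklore] -/
theorem rect_subset_halfPlane {r₁ r₂ z₁ z₂ : ℝ} (hr : 0 ≤ r₁) : rect r₁ r₂ z₁ z₂ ⊆ halfPlane :=
  fun _ hq => hr.trans_lt (mem_rect.1 hq).1.1

/-- A closed rectangle with `r₁ > 0` lies in the half-plane. [folklore] -/
theorem crect_subset_halfPlane {r₁ r₂ z₁ z₂ : ℝ} (hr : 0 < r₁) : crect r₁ r₂ z₁ z₂ ⊆ halfPlane :=
  fun _ hq => hr.trans_le (mem_crect.1 hq).1.1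

/-! ### Theorem 3.4 (edge-effect cut-offs) as named facts -/

/-- **Ożański 2017, Theorem 3.4, rectangle case (App. A, "the cut-off function on a
rectangle"; held-text Lemma 21; Scheffer 1985, Lemmas 5.3–5.4).** Let `U ⋐ P` be an open
rectangle, `U = (a₁,b₁) × (a₂,b₂)` with `b₁ > a₁`, `b₂ > a₂ > 0` (here `rect r₁ r₂ z₁ z₂`, radial
interval `(r₁,r₂) = (a₂,b₂)`). Given `η > 0` there exist `δ ∈ (0, η)` and
`f ∈ C_0^∞(P; [0,1])` such that `supp f = Ū`, `f > 0` in `U` with `f = 1` on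
`U_η = (r₁+η, r₂-η) × (z₁+η, z₂-η)`, `Lf > 0` in `U ∖ U_δ`, and `f` is symmetric with respect to
the vertical axis of `U`: `f((a₁+b₁)/2 - x₁, x₂) = f((a₁+b₁)/2 + x₁, x₂)` (axial reflection about
the midline `z = (z₁+z₂)/2`). Nothing asserted; users take `(h : Ozanski2017_cutoff_rect)`.
[cite: Ozanski2017NSISingular, Theorem 3.4 and App. A (rectangle lemma)]
[cite: Scheffer1985, Lemmas 5.3–5.4] -/
def Ozanski2017_cutoff_rect : Prop :=
  ∀ (r₁ r₂ z₁ z₂ : ℝ), 0 < r₁ → r₁ < r₂ → z₁ < z₂ → ∀ η : ℝ, 0 < η →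
    ∃ δ ∈ Ioo (0 : ℝ) η, ∃ f : ℝ × ℝ → ℝ, ContDiff ℝ ∞ f ∧ (∀ q, f q ∈ Icc (0 : ℝ) 1) ∧
      tsupport f = closure (rect r₁ r₂ z₁ z₂) ∧ (∀ q ∈ rect r₁ r₂ z₁ z₂, 0 < f q) ∧
      (∀ q ∈ rect (r₁ + η) (r₂ - η) (z₁ + η) (z₂ - η), f q = 1) ∧
      (∀ q ∈ rect r₁ r₂ z₁ z₂ \ rect (r₁ + δ) (r₂ - δ) (z₁ + δ) (z₂ - δ), 0 < opL f q) ∧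
      (∀ r z, f (r, (z₁ + z₂) / 2 - z) = f (r, (z₁ + z₂) / 2 + z))

/-- **Ożański 2017, Theorem 3.4, rectangular-ring case (App. A, "the cut-off function on a
rectangular ring"; held-text Lemma 22; Scheffer 1985, Lemma 5.5).** Let `U = V ∖ W̄ ⋐ P` with
`V = (R₁,R₂) × (Z₁,Z₂)`, `W = (r₁,r₂) × (z₁,z₂)` open rectangles, `W ⋐ V`, `R₁ > 0`. Given
`η > 0` there exist `δ ∈ (0, η)` and `f ∈ C_0^∞(P; [0,1])` with `supp f = Ū`, `f > 0` in `U`,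
`f = 1` on `U_η`, `Lf > 0` in `U ∖ U_δ`. Here `U_η = {x ∈ U : dist(x, ∂U) > η}` is rendered as
`V_η ∖ (W̄ enlarged by η)` with the enlarged rectangle closed and with sharp corners, i.e. for
the sup metric of `ℝ × ℝ`; for the Euclidean metric of the source the enlargement has rounded
corners and lies between the sup-enlargements by `η/√2` and `η`, so the two readings of the
statement are equivalent (given `η`, apply one to get `δ`, and shrink `δ` by `√2`). The
symmetry clause of the rectangle case is not repeated. Nothing asserted.
[cite: Ozanski2017NSISingular, Theorem 3.4 and App. A (ring lemma)] [cite: Scheffer1985, Lemma 5.5] -/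
def Ozanski2017_cutoff_ring : Prop :=
  ∀ (R₁ R₂ Z₁ Z₂ r₁ r₂ z₁ z₂ : ℝ), 0 < R₁ → R₁ < r₁ → r₁ < r₂ → r₂ < R₂ → Z₁ < z₁ → z₁ < z₂ →
    z₂ < Z₂ → ∀ η : ℝ, 0 < η →
    ∃ δ ∈ Ioo (0 : ℝ) η, ∃ f : ℝ × ℝ → ℝ, ContDiff ℝ ∞ f ∧ (∀ q, f q ∈ Icc (0 : ℝ) 1) ∧
      tsupport f = closure (rect R₁ R₂ Z₁ Z₂ \ crect r₁ r₂ z₁ z₂) ∧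
      (∀ q ∈ rect R₁ R₂ Z₁ Z₂ \ crect r₁ r₂ z₁ z₂, 0 < f q) ∧
      (∀ q ∈ rect (R₁ + η) (R₂ - η) (Z₁ + η) (Z₂ - η) \ crect (r₁ - η) (r₂ + η) (z₁ - η) (z₂ + η),
        f q = 1) ∧
      (∀ q ∈ (rect R₁ R₂ Z₁ Z₂ \ crect r₁ r₂ z₁ z₂) \
          (rect (R₁ + δ) (R₂ - δ) (Z₁ + δ) (Z₂ - δ) \ crect (r₁ - δ) (r₂ + δ) (z₁ - δ) (z₂ + δ)),
        0 < opL f q)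

/-! ### The cut-off `φ` and margins -/

/-- **A smooth cut-off equal to `1` on a compact set**: for `K` compact inside `U` open (in
`ℝ × ℝ`) there is `φ ∈ C_c^∞(U; [0,1])` with `φ = 1` on `K` (the `φ` of the recipe, §3.5:
"take any cut-off function `φ ∈ C_0^∞(U;[0,1])` such that `φ = 1` on `U_δ`"). Built as
`g₁/(g₁+g₂)` from Mathlib's smooth functions with prescribed open support.
[cite: Ozanski2017NSISingular, §3.5 (last paragraph)] -/
theorem exists_cutoff_eq_one {U K : Set (ℝ × ℝ)} (hU : IsOpen U) (hK : IsCompact K)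
    (hKU : K ⊆ U) :
    ∃ φ : ℝ × ℝ → ℝ, ContDiff ℝ ∞ φ ∧ (∀ q, φ q ∈ Icc (0 : ℝ) 1) ∧ (∀ q ∈ K, φ q = 1) ∧
      tsupport φ ⊆ U ∧ HasCompactSupport φ := by
  obtain ⟨V, hVo, hKV, hVU, hVc⟩ := exists_open_between_and_isCompact_closure hK hU hKU
  obtain ⟨g₁, hg₁s, hg₁d, hg₁r⟩ := hVo.exists_contDiff_support_eq (n := ⊤)
  obtain ⟨g₂, hg₂s, hg₂d, hg₂r⟩ := hK.isClosed.isOpen_compl.exists_contDiff_support_eq (n := ⊤)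
  have h1 : ∀ q, 0 ≤ g₁ q ∧ g₁ q ≤ 1 := fun q => hg₁r (mem_range_self q)
  have h2 : ∀ q, 0 ≤ g₂ q ∧ g₂ q ≤ 1 := fun q => hg₂r (mem_range_self q)
  have hpos : ∀ q, 0 < g₁ q + g₂ q := by
    intro q
    by_cases hq : q ∈ V
    · have : g₁ q ≠ 0 := by rw [← mem_support, hg₁s]; exact hq
      exact add_pos_of_pos_of_nonneg (lt_of_le_of_ne (h1 q).1 this.symm) (h2 q).1
    · have hqK : q ∈ Kᶜ := fun h => hq (hKV h)
      have : g₂ q ≠ 0 := by rw [← mem_support, hg₂s]; exact hqK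
      exact add_pos_of_nonneg_of_pos (h1 q).1 (lt_of_le_of_ne (h2 q).1 this.symm)
  refine ⟨fun q => g₁ q / (g₁ q + g₂ q), hg₁d.div (hg₁d.add hg₂d) fun q => (hpos q).ne', ?_, ?_,
    ?_, ?_⟩
  · intro q
    refine ⟨div_nonneg (h1 q).1 (hpos q).le, ?_⟩
    rw [div_le_one (hpos q)]
    linarith [(h2 q).1]
  · intro q hq
    have : g₂ q = 0 := by rw [← notMem_support, hg₂s]; exact fun h => h hq
    have h0 : g₁ q ≠ 0 := by rw [← mem_support, hg₁s]; exact hKV hq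
    change g₁ q / (g₁ q + g₂ q) = 1
    rw [this, add_zero, div_self h0]
  · have hs : support (fun q => g₁ q / (g₁ q + g₂ q)) ⊆ V := by
      intro q hq
      rw [mem_support] at hq
      rw [← hg₁s, mem_support]
      intro h0
      exact hq (by rw [h0, zero_div])
    exact (closure_mono hs).trans hVU
  · refine HasCompactSupport.intro' hVc isClosed_closure fun q hq => ?_
    have : g₁ q = 0 := by
      rw [← notMem_support, hg₁s]
      exact fun h => hq (subset_closure h)
    simp [this]

/-- **Margins in a rectangle**: a compact subset of an open rectangle lies in a strictly
smaller one (`K ⊆ U ⟹ K ⊆ U_η` for some `η > 0`). [folklore] -/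
theorem exists_margin_rect {K : Set (ℝ × ℝ)} (hK : IsCompact K) {r₁ r₂ z₁ z₂ : ℝ}
    (hKU : K ⊆ rect r₁ r₂ z₁ z₂) :
    ∃ η : ℝ, 0 < η ∧ K ⊆ rect (r₁ + η) (r₂ - η) (z₁ + η) (z₂ - η) := by
  rcases K.eq_empty_or_nonempty with rfl | hne
  · exact ⟨1, one_pos, empty_subset _⟩
  -- the continuous function `margin q = min (min (q.1 - r₁) (r₂ - q.1)) (min (q.2 - z₁) (z₂ - q.2))`
  set m : ℝ × ℝ → ℝ := fun q => min (min (q.1 - r₁) (r₂ - q.1)) (min (q.2 - z₁) (z₂ - q.2))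
  have hm : Continuous m := by fun_prop
  obtain ⟨q₀, hq₀, hmin⟩ := hK.exists_isMinOn hne hm.continuousOn
  have hpos : 0 < m q₀ := by
    have h := mem_rect.1 (hKU hq₀)
    simp only [m, lt_min_iff, sub_pos]
    exact ⟨⟨h.1.1, h.1.2⟩, h.2.1, h.2.2⟩
  refine ⟨m q₀ / 2, by positivity, fun q hq => ?_⟩
  have hle : m q₀ ≤ m q := hmin hq
  have h4 : m q ≤ q.1 - r₁ ∧ m q ≤ r₂ - q.1 ∧ m q ≤ q.2 - z₁ ∧ m q ≤ z₂ - q.2 := by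
    simp only [m]
    refine ⟨?_, ?_, ?_, ?_⟩
    · exact (min_le_left _ _).trans (min_le_left _ _)
    · exact (min_le_left _ _).trans (min_le_right _ _)
    · exact (min_le_right _ _).trans (min_le_left _ _)
    · exact (min_le_right _ _).trans (min_le_right _ _)
  rw [mem_rect]
  refine ⟨⟨?_, ?_⟩, ?_, ?_⟩ <;> linarith [h4.1, h4.2.1, h4.2.2.1, h4.2.2.2]

/-- **Margins in a rectangular ring**: a compact subset of `V ∖ W̄` lies in
`V_η ∖ (W̄ enlarged by η)` for some `η > 0`. [folklore] -/
theorem exists_margin_ring {K : Set (ℝ × ℝ)} (hK : IsCompact K) {R₁ R₂ Z₁ Z₂ r₁ r₂ z₁ z₂ : ℝ}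
    (hKU : K ⊆ rect R₁ R₂ Z₁ Z₂ \ crect r₁ r₂ z₁ z₂) :
    ∃ η : ℝ, 0 < η ∧
      K ⊆ rect (R₁ + η) (R₂ - η) (Z₁ + η) (Z₂ - η) \ crect (r₁ - η) (r₂ + η) (z₁ - η) (z₂ + η) := by
  obtain ⟨η₁, hη₁, hK₁⟩ := exists_margin_rect hK (hKU.trans sdiff_subset)
  rcases K.eq_empty_or_nonempty with rfl | hne
  · exact ⟨1, one_pos, empty_subset _⟩
  -- the "excess over `W̄`" `e(q) = max (max (r₁ - q.1) (q.1 - r₂)) (max (z₁ - q.2) (q.2 - z₂))`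
  -- is continuous, positive exactly off `W̄`, and `q` lies in `W̄` enlarged by `η` iff `e q ≤ η`
  set e : ℝ × ℝ → ℝ := fun q => max (max (r₁ - q.1) (q.1 - r₂)) (max (z₁ - q.2) (q.2 - z₂))
  have he : Continuous e := by fun_prop
  obtain ⟨q₀, hq₀, hmin⟩ := hK.exists_isMinOn hne he.continuousOn
  have hpos : 0 < e q₀ := by
    have hq₀W : q₀ ∉ crect r₁ r₂ z₁ z₂ := (hKU hq₀).2
    rw [mem_crect] at hq₀W
    simp only [e, lt_max_iff, sub_pos]
    by_contra h
    push Not at h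
    exact hq₀W ⟨⟨by linarith [h.1.1], by linarith [h.1.2]⟩, by linarith [h.2.1], by linarith [h.2.2]⟩
  set η : ℝ := min η₁ (e q₀ / 2)
  have hη : 0 < η := lt_min hη₁ (by positivity)
  have hηle : η ≤ η₁ := min_le_left _ _
  have hηe : η < e q₀ := (min_le_right _ _).trans_lt (by linarith)
  refine ⟨η, hη, fun q hq => ⟨?_, fun hqW => ?_⟩⟩
  · exact rect_mono (by linarith) (by linarith) (by linarith) (by linarith) (hK₁ hq)
  · rw [mem_crect] at hqW
    have hle : e q₀ ≤ e q := hmin hq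
    have heq : e q ≤ η := by
      simp only [e, max_le_iff]
      exact ⟨⟨by linarith [hqW.1.1], by linarith [hqW.1.2]⟩, by linarith [hqW.2.1],
        by linarith [hqW.2.2]⟩
    linarith

/-! ### The recipe (Ożański 2017, §3.5) -/

/-- `∂ᵣ(μ g) = μ ∂ᵣ g` for differentiable `g`. [folklore] -/
theorem derivR_const_mul {g : ℝ × ℝ → ℝ} (hg : Differentiable ℝ g) (μ : ℝ) :
    derivR (fun q => μ * g q) = fun q => μ * derivR g q := by
  funext q
  simp only [derivR, fderiv_const_mul (hg q) μ, _root_.smul_apply, smul_eq_mul]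

/-- `∂_z(μ g) = μ ∂_z g` for differentiable `g`. [folklore] -/
theorem derivZ_const_mul {g : ℝ × ℝ → ℝ} (hg : Differentiable ℝ g) (μ : ℝ) :
    derivZ (fun q => μ * g q) = fun q => μ * derivZ g q := by
  funext q
  simp only [derivZ, fderiv_const_mul (hg q) μ, _root_.smul_apply, smul_eq_mul]

/-- `∂ᵣ g` and `∂_z g` are `C¹` for `g ∈ C²`. [folklore] -/
theorem contDiff_one_derivR_derivZ {g : ℝ × ℝ → ℝ} (hg : ContDiff ℝ 2 g) :
    ContDiff ℝ 1 (derivR g) ∧ ContDiff ℝ 1 (derivZ g) := by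
  have hdf : ContDiff ℝ 1 (fderiv ℝ g) := hg.fderiv_right (by norm_num)
  exact ⟨hdf.clm_apply contDiff_const, hdf.clm_apply contDiff_const⟩

/-- `L(μ f) = μ Lf` for `f ∈ C²` (the operator `L` is linear). [folklore] -/
theorem opL_const_mul {f : ℝ × ℝ → ℝ} (hf : ContDiff ℝ 2 f) (μ : ℝ) (q : ℝ × ℝ) :
    opL (fun q => μ * f q) q = μ * opL f q := by
  have hf1 : Differentiable ℝ f := hf.differentiable (by norm_num)
  have hdR : Differentiable ℝ (derivR f) :=
    (contDiff_one_derivR_derivZ hf).1.differentiable one_ne_zero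
  have hdZ : Differentiable ℝ (derivZ f) :=
    (contDiff_one_derivR_derivZ hf).2.differentiable one_ne_zero
  simp only [opL, derivR_const_mul hf1, derivZ_const_mul hf1, derivR_const_mul hdR,
    derivZ_const_mul hdZ]
  ring

/-- `tsupport (μ f) = tsupport f` for `μ ≠ 0`. [folklore] -/
theorem tsupport_const_mul {f : ℝ × ℝ → ℝ} {μ : ℝ} (hμ : μ ≠ 0) :
    tsupport (fun q => μ * f q) = tsupport f := by
  simp only [tsupport]
  congr 1
  ext q
  simp [mem_support, hμ]

/-- **The recipe for a structure, abstract form (Ożański 2017, §3.5).** Let `U` be open with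
compact closure in the half-plane; let `f₀ ∈ C^∞(ℝ²; [0,1])` with `supp f₀ = Ū`, `f₀ > 0` in
`U`, `f₀ = 1` on a set `I_η` and `Lf₀ > 0` on `U ∖ I_δ` where `I_η ⊆ I_δ` and `Ī_δ ⊆ U`
(the conclusion of Theorem 3.4); let `v ∈ C^∞` with `supp v ⊆ I_η`, `div(r v) = 0` in `U` and
`|v| < μ`, `μ > 0`. Then with `f = μ f₀` and a cut-off `φ ∈ C_c^∞(U;[0,1])`, `φ = 1` on `Ī_δ`,
the triple `(v, f, φ)` is a structure on `U`, `f = μ` on `supp v` and `0 ≤ f ≤ μ`.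
[cite: Ozanski2017NSISingular, §3.5] -/
theorem IsNSIStructure.of_recipe {U Iη Iδ : Set (ℝ × ℝ)} {v : ℝ × ℝ → ℝ × ℝ} {f₀ : ℝ × ℝ → ℝ}
    {μ : ℝ} (hU : IsOpen U) (hUc : IsCompact (closure U)) (hUP : closure U ⊆ halfPlane)
    (hf₀ : ContDiff ℝ ∞ f₀) (hf₀m : ∀ q, f₀ q ∈ Icc (0 : ℝ) 1) (hf₀s : tsupport f₀ = closure U)
    (hf₀p : ∀ q ∈ U, 0 < f₀ q) (hf₀1 : ∀ q ∈ Iη, f₀ q = 1) (hf₀L : ∀ q ∈ U \ Iδ, 0 < opL f₀ q)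
    (hηδ : Iη ⊆ Iδ) (hδU : closure Iδ ⊆ U) (hv : ContDiff ℝ ∞ v) (hvs : tsupport v ⊆ Iη)
    (hdiv : ∀ q ∈ U, derivR (fun q' : ℝ × ℝ => q'.1 * (v q').1) q +
      derivZ (fun q' : ℝ × ℝ => q'.1 * (v q').2) q = 0)
    (hμ : 0 < μ) (hvμ : ∀ q, (v q).1 ^ 2 + (v q).2 ^ 2 < μ ^ 2) :
    ∃ φ : ℝ × ℝ → ℝ, IsNSIStructure U v (fun q => μ * f₀ q) φ ∧
      (∀ q ∈ tsupport v, μ * f₀ q = μ) ∧ (∀ q, μ * f₀ q ≤ μ) ∧ (∀ q, 0 ≤ μ * f₀ q) := by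
  have hKc : IsCompact (closure Iδ) :=
    hUc.of_isClosed_subset isClosed_closure (hδU.trans subset_closure)
  obtain ⟨φ, hφd, hφm, hφ1, hφs, -⟩ := exists_cutoff_eq_one hU hKc hδU
  refine ⟨φ, ?_, fun q hq => by rw [hf₀1 q (hvs hq), mul_one], fun q => ?_, fun q => ?_⟩
  · refine
      { isOpen := hU
        isCompact_closure := hUc
        closure_subset := hUP
        v_smooth := hv
        f_smooth := contDiff_const.mul hf₀
        φ_smooth := hφd
        f_nonneg := fun q => mul_nonneg hμ.le (hf₀m q).1
        φ_mem := hφm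
        tsupport_f := by rw [tsupport_const_mul hμ.ne', hf₀s]
        tsupport_φ := hφs
        tsupport_v := fun q hq => hφ1 q (subset_closure (hηδ (hvs hq)))
        div_eq_zero := hdiv
        sq_lt := fun q hq => ?_
        opL_pos := fun q hq hφq => ?_ }
    · by_cases hqv : q ∈ tsupport v
      · rw [hf₀1 q (hvs hqv), mul_one]; exact hvμ q
      · have h0 : v q = 0 := image_eq_zero_of_notMem_tsupport hqv
        have hp : 0 < μ * f₀ q := mul_pos hμ (hf₀p q hq)
        have hp2 : (0 : ℝ) ^ 2 + (0 : ℝ) ^ 2 < (μ * f₀ q) ^ 2 := by nlinarith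
        rw [h0]; exact hp2
    · have hqδ : q ∉ Iδ := fun h => hφq (hφ1 q (subset_closure h))
      rw [opL_const_mul (contDiff_infty.1 hf₀ 2) μ q]
      exact mul_pos hμ (hf₀L q ⟨hq, hqδ⟩)
  · have := (hf₀m q).2; nlinarith
  · exact mul_nonneg hμ.le (hf₀m q).1

/-- **The recipe on a rectangle (Ożański 2017, §3.5 with Theorem 3.4).** Given the fact
`Ozanski2017_cutoff_rect`: for an open rectangle `U = (r₁,r₂) × (z₁,z₂) ⋐ P` (`r₁ > 0`), a
field `v ∈ C^∞` with `supp v ⊆ U` and `div(r v) = 0` in `U`, and `μ > 0` with `|v| < μ`, there is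
a structure `(v, f, φ)` on `U` with `f = μ` on `supp v`, `0 ≤ f ≤ μ`, and `f` even about the
axial midline of `U`. [cite: Ozanski2017NSISingular, §3.5] -/
theorem exists_structure_rect (h34 : Ozanski2017_cutoff_rect) {r₁ r₂ z₁ z₂ : ℝ} (hr₁ : 0 < r₁)
    (hr : r₁ < r₂) (hz : z₁ < z₂) {v : ℝ × ℝ → ℝ × ℝ} (hv : ContDiff ℝ ∞ v)
    (hvs : tsupport v ⊆ rect r₁ r₂ z₁ z₂)
    (hdiv : ∀ q ∈ rect r₁ r₂ z₁ z₂, derivR (fun q' : ℝ × ℝ => q'.1 * (v q').1) q +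
      derivZ (fun q' : ℝ × ℝ => q'.1 * (v q').2) q = 0)
    {μ : ℝ} (hμ : 0 < μ) (hvμ : ∀ q, (v q).1 ^ 2 + (v q).2 ^ 2 < μ ^ 2) :
    ∃ f φ : ℝ × ℝ → ℝ, IsNSIStructure (rect r₁ r₂ z₁ z₂) v f φ ∧ (∀ q ∈ tsupport v, f q = μ) ∧
      (∀ q, f q ≤ μ) ∧ (∀ q, 0 ≤ f q) ∧ (∀ r z, f (r, (z₁ + z₂) / 2 - z) = f (r, (z₁ + z₂) / 2 + z)) := by
  have hUc : IsCompact (closure (rect r₁ r₂ z₁ z₂)) :=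
    (isCompact_crect r₁ r₂ z₁ z₂).of_isClosed_subset isClosed_closure (closure_rect_subset _ _ _ _)
  have hvc : IsCompact (tsupport v) :=
    hUc.of_isClosed_subset (isClosed_tsupport v) (hvs.trans subset_closure)
  obtain ⟨η, hη, hvη⟩ := exists_margin_rect hvc hvs
  obtain ⟨δ, ⟨hδ0, hδη⟩, f₀, hf₀d, hf₀m, hf₀s, hf₀p, hf₀1, hf₀L, hf₀sym⟩ :=
    h34 r₁ r₂ z₁ z₂ hr₁ hr hz η hη
  have hηδ : rect (r₁ + η) (r₂ - η) (z₁ + η) (z₂ - η) ⊆ rect (r₁ + δ) (r₂ - δ) (z₁ + δ) (z₂ - δ) :=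
    rect_mono (by linarith) (by linarith) (by linarith) (by linarith)
  have hδU : closure (rect (r₁ + δ) (r₂ - δ) (z₁ + δ) (z₂ - δ)) ⊆ rect r₁ r₂ z₁ z₂ :=
    (closure_rect_subset _ _ _ _).trans
      (crect_subset_rect (by linarith) (by linarith) (by linarith) (by linarith))
  obtain ⟨φ, hS, h1, h2, h3⟩ := IsNSIStructure.of_recipe (isOpen_rect _ _ _ _) hUc
    ((closure_rect_subset _ _ _ _).trans (crect_subset_halfPlane hr₁)) hf₀d hf₀m hf₀s hf₀p hf₀1
    hf₀L hηδ hδU hv hvη hdiv hμ hvμ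
  exact ⟨_, φ, hS, h1, h2, h3, fun r z => by rw [hf₀sym r z]⟩

/-- **The recipe on a rectangular ring (Ożański 2017, §3.5 with Theorem 3.4; used for
`U₂` in §5.5).** Given the fact `Ozanski2017_cutoff_ring`: for `U = V ∖ W̄ ⋐ P` a rectangular
ring, `v ∈ C^∞` with `supp v ⊆ U`, `div(r v) = 0` in `U`, and `μ > 0` with `|v| < μ`, there is a
structure `(v, f, φ)` on `U` with `f = μ` on `supp v` and `0 ≤ f ≤ μ`.
[cite: Ozanski2017NSISingular, §3.5 and §5.5 (first paragraph)] -/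
theorem exists_structure_ring (h34 : Ozanski2017_cutoff_ring) {R₁ R₂ Z₁ Z₂ r₁ r₂ z₁ z₂ : ℝ}
    (hR₁ : 0 < R₁) (h₁ : R₁ < r₁) (h₂ : r₁ < r₂) (h₃ : r₂ < R₂) (h₄ : Z₁ < z₁) (h₅ : z₁ < z₂)
    (h₆ : z₂ < Z₂) {v : ℝ × ℝ → ℝ × ℝ} (hv : ContDiff ℝ ∞ v)
    (hvs : tsupport v ⊆ rect R₁ R₂ Z₁ Z₂ \ crect r₁ r₂ z₁ z₂)
    (hdiv : ∀ q ∈ rect R₁ R₂ Z₁ Z₂ \ crect r₁ r₂ z₁ z₂,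
      derivR (fun q' : ℝ × ℝ => q'.1 * (v q').1) q + derivZ (fun q' : ℝ × ℝ => q'.1 * (v q').2) q = 0)
    {μ : ℝ} (hμ : 0 < μ) (hvμ : ∀ q, (v q).1 ^ 2 + (v q).2 ^ 2 < μ ^ 2) :
    ∃ f φ : ℝ × ℝ → ℝ, IsNSIStructure (rect R₁ R₂ Z₁ Z₂ \ crect r₁ r₂ z₁ z₂) v f φ ∧
      (∀ q ∈ tsupport v, f q = μ) ∧ (∀ q, f q ≤ μ) ∧ (∀ q, 0 ≤ f q) := by
  set U : Set (ℝ × ℝ) := rect R₁ R₂ Z₁ Z₂ \ crect r₁ r₂ z₁ z₂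
  have hUo : IsOpen U := (isOpen_rect _ _ _ _).sdiff (isClosed_crect _ _ _ _)
  have hUc : IsCompact (closure U) :=
    (isCompact_crect R₁ R₂ Z₁ Z₂).of_isClosed_subset isClosed_closure
      ((closure_mono sdiff_subset).trans (closure_rect_subset _ _ _ _))
  have hvc : IsCompact (tsupport v) :=
    hUc.of_isClosed_subset (isClosed_tsupport v) (hvs.trans subset_closure)
  obtain ⟨η, hη, hvη⟩ := exists_margin_ring hvc hvs
  obtain ⟨δ, ⟨hδ0, hδη⟩, f₀, hf₀d, hf₀m, hf₀s, hf₀p, hf₀1, hf₀L⟩ :=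
    h34 R₁ R₂ Z₁ Z₂ r₁ r₂ z₁ z₂ hR₁ h₁ h₂ h₃ h₄ h₅ h₆ η hη
  have hηδ : rect (R₁ + η) (R₂ - η) (Z₁ + η) (Z₂ - η) \ crect (r₁ - η) (r₂ + η) (z₁ - η) (z₂ + η) ⊆
      rect (R₁ + δ) (R₂ - δ) (Z₁ + δ) (Z₂ - δ) \ crect (r₁ - δ) (r₂ + δ) (z₁ - δ) (z₂ + δ) :=
    sdiff_subset_sdiff (rect_mono (by linarith) (by linarith) (by linarith) (by linarith))
      (prod_mono (Icc_subset_Icc (by linarith) (by linarith))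
        (Icc_subset_Icc (by linarith) (by linarith)))
  have hδU : closure (rect (R₁ + δ) (R₂ - δ) (Z₁ + δ) (Z₂ - δ) \
      crect (r₁ - δ) (r₂ + δ) (z₁ - δ) (z₂ + δ)) ⊆ U := by
    -- `closure (A \ B̄') ⊆ closure A \ interior B̄' ⊆ crect(δ) \ rect(enlarged open)`
    intro q hq
    have hqA : q ∈ crect (R₁ + δ) (R₂ - δ) (Z₁ + δ) (Z₂ - δ) :=
      closure_rect_subset _ _ _ _ (closure_mono sdiff_subset hq)
    have hqB : q ∉ rect (r₁ - δ) (r₂ + δ) (z₁ - δ) (z₂ + δ) := by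
      intro hqB
      -- the open enlarged rectangle is a neighbourhood of `q` disjoint from the set
      have hn : rect (r₁ - δ) (r₂ + δ) (z₁ - δ) (z₂ + δ) ∈ 𝓝 q := (isOpen_rect _ _ _ _).mem_nhds hqB
      rw [mem_closure_iff_nhds] at hq
      obtain ⟨p, hp, hpA⟩ := hq _ hn
      exact hpA.2 (rect_subset_crect _ _ _ _ hp)
    refine ⟨crect_subset_rect (by linarith) (by linarith) (by linarith) (by linarith) hqA, ?_⟩
    intro hqW
    exact hqB (crect_subset_rect (by linarith) (by linarith) (by linarith) (by linarith) hqW)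
  obtain ⟨φ, hS, hf1, hf2, hf3⟩ := IsNSIStructure.of_recipe hUo hUc
    (((closure_mono sdiff_subset).trans (closure_rect_subset _ _ _ _)).trans
      (crect_subset_halfPlane hR₁)) hf₀d hf₀m hf₀s hf₀p hf₀1 hf₀L hηδ hδU hv hvη hdiv hμ hvμ
  exact ⟨_, φ, hS, hf1, hf2, hf3⟩

end Literature.Barriers.NavierStokesRegularity
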